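import Mathlib.LinearAlgebra.BilinearForm.Orthogonal
import Literature.AlgebraicGeometry.HodgeTheory.SignSymmetricTransvectionMonodromy
import HarnessLib

/-!
# The orbit-data assembly for sign-symmetric transvection monodromy

Family `hodge`, layer `Literature/AlgebraicGeometry/HodgeTheory`; sequel of
`SignSymmetricTransvectionMonodromy.lean` (Zariski density of sign-symmetric transvection monodromy in
`Sp(V₊) × Sp(V₋)`, and its §4 "Corollary T′ in sign form"). THEOREMS only; no definition, no named fact
(net debt `0`).

## Content

The consumer of `mem_glZariskiClosure_of_signSymmetric` / `mem_glIdentityComponent_of_signSymmetric`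
(route `Summits/HodgeConjecture/HodgeConjecture/Theses/SignSymmetricPowers.lean`, crux K1
`VeryGeneralSignCommutatorsInHg`, K1-B line `andre-zariski`) has to supply, for an involution-invariant
pencil, two sets of centres `T` (fixed up to sign by the involution `τ`) and `D` (`τ`-isotropic pairs) with
eight properties (transvections resp. pairs along them in `Γ`, `R_±` spanning the eigenspaces, `R_±`
orthogonally connected, seeds). This file derives all eight (`signPencil_clauses_of_orbitData`) from the
GEOMETRIC ORBIT DATA that Picard–Lefschetz theory, Zariski's conjugacy theorem and the global invariant
cycle theorem actually deliver: three generators `U_{r_P}(c₁)`, `U_{r_L}(c₂)`, `U_{δ₀}(c₃)U_{τδ₀}(c₃)` in `Γ`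
(one per irreducible component of the discriminant), `Γ` generated by conjugates of them, `V^Γ = 0`, and
two links `⟨r_P, Γδ₀⟩ ≠ 0 ≠ ⟨r_L, Γδ₀⟩`, with the ORBIT sets `T := Γ·{±r_P, ±r_L}`, `D := Γ·{±δ₀, ±τδ₀}`.

* §1 transvection units: `oneParamTransvectionEquiv_apply`, `oneParamTransvectionEquiv_neg`
  (`U_{-r} = U_r`), `conj_oneParamTransvectionEquiv` (`g U_r(c) g⁻¹ = U_{gr}(c)` for an isometry `g`),
  `conj_pair_oneParamTransvectionEquiv`.
* §2 spanning: `span_eq_top_of_generators` (no `Γ`-invariants and `Γ` generated by transvections / pairs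
  along `S` ⇒ `span S = ⊤`, via `(span S)^⊥ ⊆ V^Γ = 0` and `LinearMap.BilinForm.orthogonal_orthogonal`),
  `span_signSymmetric_eq_eigenspace_one` / `…_neg_one` (SPAN±: the projectors `½(1 ± τ)` sort the centres
  into the eigenspaces).
* §3 `signPencil_clauses_of_orbitData`: the assembly; orthogonal connectedness is
  `orthogonallyConnected_of_signSymmetric_orbits{,_neg}`, whose side conditions come out of the data
  (`r_P, r_L ≠ 0` and `δ₀ ± τδ₀ ≠ 0` from the links; the `τ`-fixed centres are `±Γr_P`, the anti-fixed ones
  `±Γr_L`; one `Γ`-orbit up to sign each; `D` one `Γ`-orbit up to sign and `τ`).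

Deliberately NOT here: any geometry (the orbit data themselves are the K1-B GEO stub), and the `ℚ`-instance
registered as stub `stub_signOrbitData` of stmt-HodgeConjecture-19716 (a `Summits/…/Theorems` file).

## References

* [Deligne1980] P. Deligne, La conjecture de Weil : II, Publ. Math. IHÉS 52 (1980), §4.4 (4.4.1)–(4.4.4^α),
  pp. 227–228.
* [Voisin2003HodgeTheoryII] C. Voisin, Hodge Theory and Complex Algebraic Geometry II (2003), Ch. 2 §2.3
  (vanishing cycles span the orthogonal of the invariant part), Ch. 3 Prop. 3.23 (conjugacy of vanishing
  cycles).
* [GoodmanWallachGTM255] R. Goodman, N. R. Wallach, Symmetry, Representations, and Invariants, §11.3.5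
  Type CII (the projectors `P_± = ½(1 ∓ J)`).
-/

noncomputable section

namespace Literature.AlgebraicGeometry.HodgeTheory

open Literature.AlgebraicGeometry.Motives Literature.LinearAlgebra.Alternating

universe u v

variable {K : Type u} [Field K] {V : Type v} [AddCommGroup V] [Module K V] {B : LinearMap.BilinForm K V}

/-! ## §1 Transvection units: evaluation, sign of the centre, conjugation -/

/-- `U_δ(c) x = x + c⟨x, δ⟩ δ` for the automorphism `oneParamTransvectionEquiv`.
[cite: Deligne1980, §4.4 Lemme (4.4.2^α) p. 227] -/
theorem oneParamTransvectionEquiv_apply {δ : V} (hδ : B δ δ = 0) (c : K) (x : V) :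
    oneParamTransvectionEquiv B hδ c x = x + (c * B x δ) • δ := by
  rw [← LinearEquiv.coe_coe, coe_oneParamTransvectionEquiv, oneParamTransvection_apply]

/-- `U_{-r}(c) = U_r(c)`: a transvection unit only depends on its centre up to sign ("`R` stable par
`a ↦ -a`"). [cite: Deligne1980, §4.4 (4.4.4^α) p. 227] -/
theorem oneParamTransvectionEquiv_neg (hB : B.IsAlt) (r : V) (c : K) :
    oneParamTransvectionEquiv B (hB (-r)) c = oneParamTransvectionEquiv B (hB r) c := by
  apply LinearEquiv.toLinearMap_injective
  rw [coe_oneParamTransvectionEquiv, coe_oneParamTransvectionEquiv, ← neg_one_smul K r,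
    oneParamTransvection_smul, mul_assoc, neg_one_mul, neg_neg, mul_one]

/-- **Conjugation of a transvection unit by an isometry**: `g U_r(c) g⁻¹ = U_{g r}(c)` ("`τ σ τ⁻¹` ranges
over the transvections in the direction `τA`"). [cite: Deligne1980, §4.4 (4.4.3^α) p. 227] -/
theorem conj_oneParamTransvectionEquiv (hB : B.IsAlt) {g : V ≃ₗ[K] V}
    (hg : ∀ x y, B (g x) (g y) = B x y) (r : V) (c : K) :
    g * oneParamTransvectionEquiv B (hB r) c * g⁻¹ = oneParamTransvectionEquiv B (hB (g r)) c := by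
  ext x
  have hx : g (g⁻¹ x) = x := by
    rw [← LinearEquiv.mul_apply, mul_inv_cancel, LinearEquiv.coe_one, id_eq]
  have hB' : B (g⁻¹ x) r = B x (g r) := by rw [← hg, hx]
  rw [LinearEquiv.mul_apply, LinearEquiv.mul_apply, oneParamTransvectionEquiv_apply,
    oneParamTransvectionEquiv_apply, map_add, map_smul, hx, hB']

/-- **Conjugation of a pair** `g (U_δ(c) U_{δ'}(c)) g⁻¹ = U_{g δ}(c) U_{g δ'}(c)` for an isometry `g`.
[cite: Deligne1980, §4.4 (4.4.3^α) p. 227] -/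
theorem conj_pair_oneParamTransvectionEquiv (hB : B.IsAlt) {g : V ≃ₗ[K] V}
    (hg : ∀ x y, B (g x) (g y) = B x y) (δ δ' : V) (c : K) :
    g * (oneParamTransvectionEquiv B (hB δ) c * oneParamTransvectionEquiv B (hB δ') c) * g⁻¹ =
      oneParamTransvectionEquiv B (hB (g δ)) c * oneParamTransvectionEquiv B (hB (g δ')) c := by
  rw [← conj_oneParamTransvectionEquiv hB hg δ c, ← conj_oneParamTransvectionEquiv hB hg δ' c]
  group

/-! ## §2 Spanning: no invariants ⇒ the centres span; the eigenspaces from sign-sorted centres -/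

/-- **No `Γ`-invariants ⇒ the centres span.** If `Γ = ⟨E⟩`, every generator acts as a transvection
`U_r(c)` along some `r ∈ S` or as a product `U_δ(c) U_{δ'}(c)` with `δ, δ' ∈ S`, and `V^Γ = 0`, then
`span S = ⊤` (`B` alternating non-degenerate, `V` finite-dimensional): a vector orthogonal to `S` is fixed
by every generator, hence by `Γ`, hence vanishes, so `(span S)^⊥ = 0`. (For the monodromy of a Lefschetz
pencil: the vanishing cycles span the orthogonal of the invariants, Voisin II Cor. 2.22 / Lemma 2.26.)
[cite: Voisin2003HodgeTheoryII, Ch. 2 §2.3.2 Lemma 2.26, Cor. 2.27] -/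
theorem span_eq_top_of_generators [FiniteDimensional K V] (hB : B.IsAlt) (hBn : B.Nondegenerate)
    {Γ : Subgroup (V ≃ₗ[K] V)} {E : Set (V ≃ₗ[K] V)} (hΓE : Γ = Subgroup.closure E) {S : Set V}
    (hE : ∀ e ∈ E, (∃ r ∈ S, ∃ c : K, (e : V →ₗ[K] V) = oneParamTransvection B r c) ∨
      (∃ δ ∈ S, ∃ δ' ∈ S, ∃ c : K,
        (e : V →ₗ[K] V) = oneParamTransvection B δ c * oneParamTransvection B δ' c))
    (hinv : ∀ x : V, (∀ g ∈ Γ, g x = x) → x = 0) : Submodule.span K S = ⊤ := by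
  -- a vector orthogonal to `S` vanishes
  have hzero : ∀ x : V, (∀ s ∈ S, B x s = 0) → x = 0 := by
    intro x hx
    apply hinv x
    intro g hg
    rw [hΓE] at hg
    induction hg using Subgroup.closure_induction with
    | mem e he =>
      have hae : ∀ f : V →ₗ[K] V, (e : V →ₗ[K] V) = f → e x = f x := fun f hf => by
        rw [← LinearEquiv.coe_coe, hf]
      rcases hE e he with ⟨r, hr, c, hec⟩ | ⟨δ, hδ, δ', hδ', c, hec⟩
      · rw [hae _ hec, oneParamTransvection_apply, hx r hr, mul_zero, zero_smul, add_zero]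
      · rw [hae _ hec, Module.End.mul_apply, oneParamTransvection_apply B δ' c x, hx δ' hδ', mul_zero,
          zero_smul, add_zero, oneParamTransvection_apply, hx δ hδ, mul_zero, zero_smul, add_zero]
    | one => rw [LinearEquiv.coe_one, id_eq]
    | mul g h _ _ ihg ihh => rw [LinearEquiv.mul_apply, ihh, ihg]
    | inv g _ ih =>
      conv_lhs => rw [← ih]
      rw [← LinearEquiv.mul_apply, inv_mul_cancel, LinearEquiv.coe_one, id_eq]
  -- hence `(span S)^⊥ = ⊥` and `span S = ⊤`
  have horth : B.orthogonal (Submodule.span K S) = ⊥ := by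
    rw [eq_bot_iff]
    intro m hm
    rw [LinearMap.BilinForm.mem_orthogonal_iff] at hm
    rw [Submodule.mem_bot]
    refine hzero m fun s hs => ?_
    rw [← hB.neg_eq, hm s (Submodule.subset_span hs), neg_zero]
  rw [← LinearMap.BilinForm.orthogonal_orthogonal hBn hB.isRefl (Submodule.span K S), horth,
    LinearMap.BilinForm.orthogonal_bot]

/-- **SPAN⁺**: if `τ² = 1`, every `r ∈ T` satisfies `τ r = ±r`, and `T ∪ D` spans `V`, then
`{r ∈ T | τ r = r} ∪ {δ + τδ | δ ∈ D}` spans the `+1`-eigenspace of `τ` (apply the projector `½(1 + τ)`,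
`char K ≠ 2`). [cite: GoodmanWallachGTM255, §11.3.5 Type CII (11.10)] -/
theorem span_signSymmetric_eq_eigenspace_one (h2 : (2 : K) ≠ 0) {τ : V →ₗ[K] V} (hτ : τ ^ 2 = 1)
    {T D : Set V} (hT : ∀ r ∈ T, τ r = r ∨ τ r = -r) (hsp : Submodule.span K (T ∪ D) = ⊤) :
    Submodule.span K ({r ∈ T | τ r = r} ∪ (fun δ => δ + τ δ) '' D) = Module.End.eigenspace τ 1 := by
  have hττ : ∀ x, τ (τ x) = x := fun x => by
    rw [← Module.End.mul_apply, ← pow_two, hτ, Module.End.one_apply]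
  apply le_antisymm
  · rw [Submodule.span_le]
    rintro x (⟨-, hx⟩ | ⟨δ, -, rfl⟩)
    · rw [SetLike.mem_coe, Module.End.mem_eigenspace_iff, one_smul]
      exact hx
    · rw [SetLike.mem_coe, Module.End.mem_eigenspace_iff, one_smul, map_add, hττ, add_comm]
  · intro v hv
    have hv' : halfProj τ v = v := halfProj_apply_of_mem h2 hv
    have key : ∀ s ∈ T ∪ D,
        halfProj τ s ∈ Submodule.span K ({r ∈ T | τ r = r} ∪ (fun δ => δ + τ δ) '' D) := by
      rintro s (hs | hs)
      · rcases hT s hs with h | h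
        · rw [halfProj_apply_of_mem h2 (by rw [Module.End.mem_eigenspace_iff, one_smul]; exact h)]
          exact Submodule.subset_span (Or.inl ⟨hs, h⟩)
        · rw [halfProj_apply, h, add_neg_cancel, smul_zero]
          exact Submodule.zero_mem _
      · rw [halfProj_apply]
        exact Submodule.smul_mem _ _ (Submodule.subset_span (Or.inr ⟨s, hs, rfl⟩))
    have hmap : Submodule.map (halfProj τ) (Submodule.span K (T ∪ D)) ≤
        Submodule.span K ({r ∈ T | τ r = r} ∪ (fun δ => δ + τ δ) '' D) := by
      rw [Submodule.map_span, Submodule.span_le]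
      rintro _ ⟨s, hs, rfl⟩
      exact key s hs
    rw [← hv']
    exact hmap ⟨v, by rw [hsp]; exact Submodule.mem_top, rfl⟩

/-- **SPAN⁻**: under the same hypotheses `{r ∈ T | τ r = -r} ∪ {δ - τδ | δ ∈ D}` spans the
`-1`-eigenspace of `τ` (SPAN⁺ for `-τ`). [cite: GoodmanWallachGTM255, §11.3.5 Type CII (11.10)] -/
theorem span_signSymmetric_eq_eigenspace_neg_one (h2 : (2 : K) ≠ 0) {τ : V →ₗ[K] V} (hτ : τ ^ 2 = 1)
    {T D : Set V} (hT : ∀ r ∈ T, τ r = r ∨ τ r = -r) (hsp : Submodule.span K (T ∪ D) = ⊤) :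
    Submodule.span K ({r ∈ T | τ r = -r} ∪ (fun δ => δ - τ δ) '' D) = Module.End.eigenspace τ (-1) := by
  have hsetT : {r ∈ T | (-τ) r = r} = {r ∈ T | τ r = -r} := by
    ext r
    simp only [Set.mem_setOf_eq, LinearMap.neg_apply, neg_eq_iff_eq_neg]
  have hsetD : (fun δ => δ + (-τ) δ) '' D = (fun δ => δ - τ δ) '' D := by
    refine Set.image_congr fun δ _ => ?_
    rw [LinearMap.neg_apply, sub_eq_add_neg]
  have hT' : ∀ r ∈ T, (-τ) r = r ∨ (-τ) r = -r := by
    intro r hr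
    rcases hT r hr with h | h
    · exact Or.inr (by rw [LinearMap.neg_apply, h])
    · exact Or.inl (by rw [LinearMap.neg_apply, h, neg_neg])
  rw [← hsetT, ← hsetD, ← eigenspace_neg_one]
  exact span_signSymmetric_eq_eigenspace_one h2 (neg_sq_eq_one hτ) hT' hsp

/-! ## §3 The orbit-data assembly over a field with `2 ≠ 0` -/

/-- **The orbit-data assembly.** `V` finite-dimensional over a field with `2 ≠ 0`, `B` alternating
non-degenerate, `τ² = 1` a `B`-isometry, `Γ ≤ GL(V)` commuting with `τ` and preserving `B`; three
Picard–Lefschetz generators `U_{r_P}(c₁)`, `U_{r_L}(c₂)`, `U_{δ₀}(c₃) U_{τδ₀}(c₃)` in `Γ` (`τ r_P = r_P`,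
`τ r_L = -r_L`, `⟨δ₀, τδ₀⟩ = 0`, `cᵢ ≠ 0`); `Γ = ⟨E⟩` with every `e ∈ E` a `Γ`-conjugate of one of the three
(Zariski's theorem: the meridians of one irreducible component of the discriminant are conjugate); no
`Γ`-invariants; two links `⟨r_P, g δ₀⟩ ≠ 0`, `⟨r_L, g' δ₀⟩ ≠ 0`. THEN for the orbit sets `T := Γ·{±r_P, ±r_L}`,
`D := Γ·{±δ₀, ±τδ₀}` and `R_± := {r ∈ T | τ r = ±r} ∪ {δ ± τδ | δ ∈ D}`: every `r ∈ T` is the centre of a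
transvection `U_r(c) ∈ Γ` (`c ≠ 0`); every `δ ∈ D` is `τ`-isotropic with `U_δ(c) U_{τδ}(c) ∈ Γ` (`c ≠ 0`);
`span R_± = V_±`; `R_±` is orthogonally connected (`orthogonallyConnected_of_signSymmetric_orbits{,_neg}`);
and `T` contains a centre of each parity — i.e. exactly the hypotheses `hT`, `hD`, `hspanPos/Neg`,
`hconnPos/Neg`, `hseedPos/Neg` of `mem_glZariskiClosure_of_signSymmetric` /
`mem_glIdentityComponent_of_signSymmetric`. (Deligne's (4.4.2^α)–(4.4.4^α) for ONE conjugacy class of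
vanishing cycles, in the sign-symmetric setting of two fixed-centre classes and one paired class.)
[cite: Deligne1980, §4.4 Thm (4.4.1), (4.4.2^α)–(4.4.4^α) pp. 227–228] -/
theorem signPencil_clauses_of_orbitData [Module.Finite K V] (hB : B.IsAlt) (hBn : B.Nondegenerate)
    (h2 : (2 : K) ≠ 0) {τ : V →ₗ[K] V} (hτ : τ ^ 2 = 1) (hτB : ∀ x y, B (τ x) (τ y) = B x y)
    {Γ : Subgroup (V ≃ₗ[K] V)} (hΓτ : ∀ g ∈ Γ, ∀ x, g (τ x) = τ (g x))
    (hΓB : ∀ g ∈ Γ, ∀ x y, B (g x) (g y) = B x y)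
    {rP rL δ₀ : V} {c₁ c₂ c₃ : K} {E : Set (V ≃ₗ[K] V)}
    (hrP : τ rP = rP) (hrL : τ rL = -rL) (hδ₀ : B δ₀ (τ δ₀) = 0)
    (hc₁ : c₁ ≠ 0) (hc₂ : c₂ ≠ 0) (hc₃ : c₃ ≠ 0)
    (huP : oneParamTransvectionEquiv B (hB rP) c₁ ∈ Γ) (huL : oneParamTransvectionEquiv B (hB rL) c₂ ∈ Γ)
    (huδ : oneParamTransvectionEquiv B (hB δ₀) c₃ * oneParamTransvectionEquiv B (hB (τ δ₀)) c₃ ∈ Γ)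
    (hΓE : Γ = Subgroup.closure E)
    (hE : ∀ e ∈ E, ∃ g ∈ Γ, e = g * oneParamTransvectionEquiv B (hB rP) c₁ * g⁻¹ ∨
      e = g * oneParamTransvectionEquiv B (hB rL) c₂ * g⁻¹ ∨
      e = g * (oneParamTransvectionEquiv B (hB δ₀) c₃ * oneParamTransvectionEquiv B (hB (τ δ₀)) c₃) * g⁻¹)
    (hinv : ∀ x : V, (∀ g ∈ Γ, g x = x) → x = 0)
    (hlinkP : ∃ g ∈ Γ, B rP (g δ₀) ≠ 0) (hlinkL : ∃ g ∈ Γ, B rL (g δ₀) ≠ 0) :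
    let T : Set V := {x | ∃ g ∈ Γ, x = g rP ∨ x = -(g rP) ∨ x = g rL ∨ x = -(g rL)}
    let D : Set V := {x | ∃ g ∈ Γ, x = g δ₀ ∨ x = -(g δ₀) ∨ x = g (τ δ₀) ∨ x = -(g (τ δ₀))}
    let RP : Set V := {r ∈ T | τ r = r} ∪ (fun δ => δ + τ δ) '' D
    let RN : Set V := {r ∈ T | τ r = -r} ∪ (fun δ => δ - τ δ) '' D
    (∀ r ∈ T, ∃ c : K, c ≠ 0 ∧ oneParamTransvectionEquiv B (hB r) c ∈ Γ) ∧
    (∀ δ ∈ D, B δ (τ δ) = 0 ∧ ∃ c : K, c ≠ 0 ∧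
      oneParamTransvectionEquiv B (hB δ) c * oneParamTransvectionEquiv B (hB (τ δ)) c ∈ Γ) ∧
    Submodule.span K RP = Module.End.eigenspace τ 1 ∧
    (∀ A' ⊆ RP, A'.Nonempty → A' ≠ RP → ∃ r ∈ A', ∃ ρ ∈ RP, ρ ∉ A' ∧ B r ρ ≠ 0) ∧
    (RP.Nonempty → ∃ r ∈ T, τ r = r) ∧
    Submodule.span K RN = Module.End.eigenspace τ (-1) ∧
    (∀ A' ⊆ RN, A'.Nonempty → A' ≠ RN → ∃ r ∈ A', ∃ ρ ∈ RN, ρ ∉ A' ∧ B r ρ ≠ 0) ∧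
    (RN.Nonempty → ∃ r ∈ T, τ r = -r) := by
  intro T D RP RN
  have hττ : ∀ x, τ (τ x) = x := fun x => by
    rw [← Module.End.mul_apply, ← pow_two, hτ, Module.End.one_apply]
  have hinvapp : ∀ (g : V ≃ₗ[K] V) (x : V), g⁻¹ (g x) = x := fun g x => by
    rw [← LinearEquiv.mul_apply, inv_mul_cancel, LinearEquiv.coe_one, id_eq]
  have hone : ∀ x : V, (1 : V ≃ₗ[K] V) x = x := fun x => by rw [LinearEquiv.coe_one, id_eq]
  -- `v = -v` forces `v = 0` (`2 ≠ 0`)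
  have hnegself : ∀ v : V, v = -v → v = 0 := by
    intro v hv
    have h : (2 : K) • v = 0 := by
      rw [two_smul]
      nth_rw 2 [hv]
      exact add_neg_cancel v
    exact (smul_eq_zero.1 h).resolve_left h2
  -- pairing with a `τ`-fixed / `τ`-anti-fixed vector
  have hBfix : ∀ a x : V, τ a = a → B a (τ x) = B a x := fun a x ha => by rw [← hτB a (τ x), ha, hττ]
  have hBanti : ∀ a x : V, τ a = -a → B a (τ x) = -B a x := fun a x ha => by
    rw [← hτB a (τ x), ha, hττ, map_neg, LinearMap.neg_apply]
  -- the basic vectors are non-zero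
  have hrP0 : rP ≠ 0 := by
    rintro rfl
    obtain ⟨g, -, h⟩ := hlinkP
    exact h (by rw [map_zero, LinearMap.zero_apply])
  have hrL0 : rL ≠ 0 := by
    rintro rfl
    obtain ⟨g, -, h⟩ := hlinkL
    exact h (by rw [map_zero, LinearMap.zero_apply])
  have hsum0 : δ₀ + τ δ₀ ≠ 0 := by
    intro h0
    obtain ⟨g, hg, hne⟩ := hlinkP
    have h1 : τ δ₀ = -δ₀ := eq_neg_of_add_eq_zero_right h0
    have h3 : B rP (g (τ δ₀)) = B rP (g δ₀) := by rw [hΓτ g hg, hBfix rP _ hrP]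
    rw [h1, map_neg, map_neg] at h3
    apply hne
    have h4 : (2 : K) * B rP (g δ₀) = 0 := by
      rw [two_mul]
      nth_rw 1 [← h3]
      exact neg_add_cancel _
    exact (mul_eq_zero.1 h4).resolve_left h2
  have hdiff0 : δ₀ - τ δ₀ ≠ 0 := by
    intro h0
    obtain ⟨g, hg, hne⟩ := hlinkL
    have h1 : τ δ₀ = δ₀ := (sub_eq_zero.1 h0).symm
    have h3 : B rL (g (τ δ₀)) = -B rL (g δ₀) := by rw [hΓτ g hg, hBanti rL _ hrL]
    rw [h1] at h3
    apply hne
    have h4 : (2 : K) * B rL (g δ₀) = 0 := by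
      rw [two_mul]
      nth_rw 2 [h3]
      exact add_neg_cancel _
    exact (mul_eq_zero.1 h4).resolve_left h2
  -- conjugation inside `Γ`
  have hconj : ∀ g ∈ Γ, ∀ (r : V) (c : K),
      g * oneParamTransvectionEquiv B (hB r) c * g⁻¹ = oneParamTransvectionEquiv B (hB (g r)) c :=
    fun g hg r c => conj_oneParamTransvectionEquiv hB (hΓB g hg) r c
  have hconj2 : ∀ g ∈ Γ, ∀ c : K,
      g * (oneParamTransvectionEquiv B (hB δ₀) c * oneParamTransvectionEquiv B (hB (τ δ₀)) c) * g⁻¹ =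
        oneParamTransvectionEquiv B (hB (g δ₀)) c * oneParamTransvectionEquiv B (hB (τ (g δ₀))) c := by
    intro g hg c
    rw [conj_pair_oneParamTransvectionEquiv hB (hΓB g hg), hΓτ g hg]
  have hUneg : ∀ (r : V) (c : K),
      oneParamTransvectionEquiv B (hB (-r)) c = oneParamTransvectionEquiv B (hB r) c :=
    oneParamTransvectionEquiv_neg hB
  -- transvections along the orbit of `rP`, `rL`, pairs along the orbit of `δ₀`
  have hmemP : ∀ g ∈ Γ, oneParamTransvectionEquiv B (hB (g rP)) c₁ ∈ Γ := fun g hg => by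
    rw [← hconj g hg rP c₁]; exact Γ.mul_mem (Γ.mul_mem hg huP) (Γ.inv_mem hg)
  have hmemL : ∀ g ∈ Γ, oneParamTransvectionEquiv B (hB (g rL)) c₂ ∈ Γ := fun g hg => by
    rw [← hconj g hg rL c₂]; exact Γ.mul_mem (Γ.mul_mem hg huL) (Γ.inv_mem hg)
  have hmemδ : ∀ g ∈ Γ, oneParamTransvectionEquiv B (hB (g δ₀)) c₃ *
      oneParamTransvectionEquiv B (hB (τ (g δ₀))) c₃ ∈ Γ := fun g hg => by
    rw [← hconj2 g hg c₃]; exact Γ.mul_mem (Γ.mul_mem hg huδ) (Γ.inv_mem hg)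
  have horthδ : ∀ g ∈ Γ, B (g δ₀) (τ (g δ₀)) = 0 := fun g hg => by
    rw [← hΓτ g hg, hΓB g hg, hδ₀]
  -- C6
  have C6 : ∀ r ∈ T, ∃ c : K, c ≠ 0 ∧ oneParamTransvectionEquiv B (hB r) c ∈ Γ := by
    rintro _ ⟨g, hg, rfl | rfl | rfl | rfl⟩
    · exact ⟨c₁, hc₁, hmemP g hg⟩
    · exact ⟨c₁, hc₁, by rw [hUneg]; exact hmemP g hg⟩
    · exact ⟨c₂, hc₂, hmemL g hg⟩
    · exact ⟨c₂, hc₂, by rw [hUneg]; exact hmemL g hg⟩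
  -- C7
  have C7 : ∀ δ ∈ D, B δ (τ δ) = 0 ∧ ∃ c : K, c ≠ 0 ∧
      oneParamTransvectionEquiv B (hB δ) c * oneParamTransvectionEquiv B (hB (τ δ)) c ∈ Γ := by
    rintro _ ⟨g, hg, rfl | rfl | rfl | rfl⟩
    · exact ⟨horthδ g hg, c₃, hc₃, hmemδ g hg⟩
    · refine ⟨by rw [map_neg τ, map_neg B, LinearMap.neg_apply, map_neg, neg_neg, horthδ g hg], c₃, hc₃, ?_⟩
      rw [map_neg τ (g δ₀), hUneg, hUneg]
      exact hmemδ g hg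
    · have hτg : τ (g (τ δ₀)) = g δ₀ := by rw [← hΓτ g hg, hττ]
      have h0 : B (g (τ δ₀)) (g δ₀) = 0 := by rw [hΓτ g hg, ← hB.neg_eq, horthδ g hg, neg_zero]
      refine ⟨by rw [hτg, h0], c₃, hc₃, ?_⟩
      rw [hτg, (commute_oneParamTransvectionEquiv hB h0 c₃).eq, hΓτ g hg]
      exact hmemδ g hg
    · have hτg : τ (g (τ δ₀)) = g δ₀ := by rw [← hΓτ g hg, hττ]
      have h0 : B (g (τ δ₀)) (g δ₀) = 0 := by rw [hΓτ g hg, ← hB.neg_eq, horthδ g hg, neg_zero]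
      refine ⟨by rw [map_neg τ, hτg, map_neg B, LinearMap.neg_apply, map_neg, neg_neg, h0], c₃, hc₃, ?_⟩
      rw [map_neg τ, hτg, hUneg, hUneg, (commute_oneParamTransvectionEquiv hB h0 c₃).eq, hΓτ g hg]
      exact hmemδ g hg
  -- structure of `T`
  have hTτ : ∀ r ∈ T, τ r = r ∨ τ r = -r := by
    rintro _ ⟨g, hg, rfl | rfl | rfl | rfl⟩
    · exact Or.inl (by rw [← hΓτ g hg, hrP])
    · exact Or.inl (by rw [map_neg, ← hΓτ g hg, hrP])
    · exact Or.inr (by rw [← hΓτ g hg, hrL, map_neg])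
    · exact Or.inr (by rw [map_neg, ← hΓτ g hg, hrL, map_neg])
  have hTneg : ∀ r ∈ T, -r ∈ T := by
    rintro _ ⟨g, hg, rfl | rfl | rfl | rfl⟩
    · exact ⟨g, hg, Or.inr (Or.inl rfl)⟩
    · exact ⟨g, hg, Or.inl (neg_neg _)⟩
    · exact ⟨g, hg, Or.inr (Or.inr (Or.inr rfl))⟩
    · exact ⟨g, hg, Or.inr (Or.inr (Or.inl (neg_neg _)))⟩
  have hTst : ∀ g ∈ Γ, ∀ r ∈ T, g r ∈ T := by
    rintro g hg _ ⟨g', hg', rfl | rfl | rfl | rfl⟩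
    · exact ⟨g * g', Γ.mul_mem hg hg', Or.inl (by rw [LinearEquiv.mul_apply])⟩
    · exact ⟨g * g', Γ.mul_mem hg hg', Or.inr (Or.inl (by rw [map_neg, LinearEquiv.mul_apply]))⟩
    · exact ⟨g * g', Γ.mul_mem hg hg', Or.inr (Or.inr (Or.inl (by rw [LinearEquiv.mul_apply])))⟩
    · exact ⟨g * g', Γ.mul_mem hg hg', Or.inr (Or.inr (Or.inr (by rw [map_neg, LinearEquiv.mul_apply])))⟩
  have hT0 : ∀ r ∈ T, r ≠ 0 := by
    rintro _ ⟨g, hg, rfl | rfl | rfl | rfl⟩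
    · exact fun h => hrP0 ((LinearEquiv.map_eq_zero_iff g).1 h)
    · exact fun h => hrP0 ((LinearEquiv.map_eq_zero_iff g).1 (neg_eq_zero.1 h))
    · exact fun h => hrL0 ((LinearEquiv.map_eq_zero_iff g).1 h)
    · exact fun h => hrL0 ((LinearEquiv.map_eq_zero_iff g).1 (neg_eq_zero.1 h))
  -- the `τ`-fixed centres are `±Γ rP`, the anti-fixed ones `±Γ rL`
  have hTfix : ∀ r ∈ T, τ r = r → ∃ g ∈ Γ, r = g rP ∨ r = -(g rP) := by
    rintro _ ⟨g, hg, rfl | rfl | rfl | rfl⟩ hr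
    · exact ⟨g, hg, Or.inl rfl⟩
    · exact ⟨g, hg, Or.inr rfl⟩
    · exfalso
      have h' : τ (g rL) = -(g rL) := by rw [← hΓτ g hg, hrL, map_neg]
      exact hT0 _ ⟨g, hg, Or.inr (Or.inr (Or.inl rfl))⟩ (hnegself _ (hr.symm.trans h'))
    · exfalso
      have h' : τ (-(g rL)) = -(-(g rL)) := by rw [map_neg, ← hΓτ g hg, hrL, map_neg]
      exact hT0 _ ⟨g, hg, Or.inr (Or.inr (Or.inr rfl))⟩ (hnegself _ (hr.symm.trans h'))
  have hTanti : ∀ r ∈ T, τ r = -r → ∃ g ∈ Γ, r = g rL ∨ r = -(g rL) := by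
    rintro _ ⟨g, hg, rfl | rfl | rfl | rfl⟩ hr
    · exfalso
      have h' : τ (g rP) = g rP := by rw [← hΓτ g hg, hrP]
      exact hT0 _ ⟨g, hg, Or.inl rfl⟩ (hnegself _ (h'.symm.trans hr))
    · exfalso
      have h' : τ (-(g rP)) = -(g rP) := by rw [map_neg, ← hΓτ g hg, hrP]
      exact hT0 _ ⟨g, hg, Or.inr (Or.inl rfl)⟩ (hnegself _ (h'.symm.trans hr))
    · exact ⟨g, hg, Or.inl rfl⟩
    · exact ⟨g, hg, Or.inr rfl⟩
  have htransTP : ∀ r ∈ T, ∀ r' ∈ T, τ r = r → τ r' = r' → ∃ g ∈ Γ, g r = r' ∨ g r = -r' := by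
    intro r hr r' hr' hτr hτr'
    obtain ⟨g, hg, hgr⟩ := hTfix r hr hτr
    obtain ⟨g', hg', hgr'⟩ := hTfix r' hr' hτr'
    refine ⟨g' * g⁻¹, Γ.mul_mem hg' (Γ.inv_mem hg), ?_⟩
    rcases hgr with rfl | rfl <;> rcases hgr' with rfl | rfl
    · left; rw [LinearEquiv.mul_apply, hinvapp]
    · right; rw [LinearEquiv.mul_apply, hinvapp, neg_neg]
    · right; rw [map_neg, LinearEquiv.mul_apply, hinvapp]
    · left; rw [map_neg, LinearEquiv.mul_apply, hinvapp]
  have htransTN : ∀ r ∈ T, ∀ r' ∈ T, τ r = -r → τ r' = -r' → ∃ g ∈ Γ, g r = r' ∨ g r = -r' := by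
    intro r hr r' hr' hτr hτr'
    obtain ⟨g, hg, hgr⟩ := hTanti r hr hτr
    obtain ⟨g', hg', hgr'⟩ := hTanti r' hr' hτr'
    refine ⟨g' * g⁻¹, Γ.mul_mem hg' (Γ.inv_mem hg), ?_⟩
    rcases hgr with rfl | rfl <;> rcases hgr' with rfl | rfl
    · left; rw [LinearEquiv.mul_apply, hinvapp]
    · right; rw [LinearEquiv.mul_apply, hinvapp, neg_neg]
    · right; rw [map_neg, LinearEquiv.mul_apply, hinvapp]
    · left; rw [map_neg, LinearEquiv.mul_apply, hinvapp]
  -- structure of `D`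
  have hDneg : ∀ δ ∈ D, -δ ∈ D := by
    rintro _ ⟨g, hg, rfl | rfl | rfl | rfl⟩
    · exact ⟨g, hg, Or.inr (Or.inl rfl)⟩
    · exact ⟨g, hg, Or.inl (neg_neg _)⟩
    · exact ⟨g, hg, Or.inr (Or.inr (Or.inr rfl))⟩
    · exact ⟨g, hg, Or.inr (Or.inr (Or.inl (neg_neg _)))⟩
  have hDst : ∀ g ∈ Γ, ∀ δ ∈ D, g δ ∈ D := by
    rintro g hg _ ⟨g', hg', rfl | rfl | rfl | rfl⟩
    · exact ⟨g * g', Γ.mul_mem hg hg', Or.inl (by rw [LinearEquiv.mul_apply])⟩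
    · exact ⟨g * g', Γ.mul_mem hg hg', Or.inr (Or.inl (by rw [map_neg, LinearEquiv.mul_apply]))⟩
    · exact ⟨g * g', Γ.mul_mem hg hg', Or.inr (Or.inr (Or.inl (by rw [LinearEquiv.mul_apply])))⟩
    · exact ⟨g * g', Γ.mul_mem hg hg', Or.inr (Or.inr (Or.inr (by rw [map_neg, LinearEquiv.mul_apply])))⟩
  have hDτ : ∀ δ ∈ D, τ δ ∈ D := by
    rintro _ ⟨g, hg, rfl | rfl | rfl | rfl⟩
    · exact ⟨g, hg, Or.inr (Or.inr (Or.inl (hΓτ g hg δ₀).symm))⟩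
    · exact ⟨g, hg, Or.inr (Or.inr (Or.inr (by rw [map_neg, hΓτ g hg])))⟩
    · exact ⟨g, hg, Or.inl (by rw [← hΓτ g hg, hττ])⟩
    · exact ⟨g, hg, Or.inr (Or.inl (by rw [map_neg, ← hΓτ g hg, hττ]))⟩
  have hdiff0' : τ δ₀ - δ₀ ≠ 0 := by rwa [← neg_sub, neg_ne_zero]
  have hD0P : ∀ δ ∈ D, δ + τ δ ≠ 0 := by
    rintro _ ⟨g, hg, rfl | rfl | rfl | rfl⟩
    · rw [← hΓτ g hg, ← map_add]
      exact fun h => hsum0 ((LinearEquiv.map_eq_zero_iff g).1 h)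
    · rw [map_neg, ← hΓτ g hg, ← neg_add, ← map_add, neg_ne_zero]
      exact fun h => hsum0 ((LinearEquiv.map_eq_zero_iff g).1 h)
    · rw [← hΓτ g hg, hττ, ← map_add, add_comm]
      exact fun h => hsum0 ((LinearEquiv.map_eq_zero_iff g).1 h)
    · rw [map_neg, ← hΓτ g hg, hττ, ← neg_add, ← map_add, neg_ne_zero, add_comm]
      exact fun h => hsum0 ((LinearEquiv.map_eq_zero_iff g).1 h)
  have hD0N : ∀ δ ∈ D, δ - τ δ ≠ 0 := by
    rintro _ ⟨g, hg, rfl | rfl | rfl | rfl⟩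
    · rw [← hΓτ g hg, ← map_sub]
      exact fun h => hdiff0 ((LinearEquiv.map_eq_zero_iff g).1 h)
    · rw [map_neg, ← hΓτ g hg, neg_sub_neg, ← map_sub]
      exact fun h => hdiff0' ((LinearEquiv.map_eq_zero_iff g).1 h)
    · rw [← hΓτ g hg, hττ, ← map_sub]
      exact fun h => hdiff0' ((LinearEquiv.map_eq_zero_iff g).1 h)
    · rw [map_neg, ← hΓτ g hg, hττ, neg_sub_neg, ← map_sub]
      exact fun h => hdiff0 ((LinearEquiv.map_eq_zero_iff g).1 h)
  -- the relation "equal up to sign and `τ`" and the transitivity of `Γ` on `D` up to it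
  have Psymm : ∀ w x : V, (x = w ∨ x = -w ∨ x = τ w ∨ x = -(τ w)) →
      (w = x ∨ w = -x ∨ w = τ x ∨ w = -(τ x)) := by
    rintro w _ (rfl | rfl | rfl | rfl)
    · exact Or.inl rfl
    · exact Or.inr (Or.inl (neg_neg w).symm)
    · exact Or.inr (Or.inr (Or.inl (hττ w).symm))
    · exact Or.inr (Or.inr (Or.inr (by rw [map_neg, hττ, neg_neg])))
  have Ptrans : ∀ w x y : V, (x = w ∨ x = -w ∨ x = τ w ∨ x = -(τ w)) →
      (y = x ∨ y = -x ∨ y = τ x ∨ y = -(τ x)) → (y = w ∨ y = -w ∨ y = τ w ∨ y = -(τ w)) := by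
    rintro w _ _ (rfl | rfl | rfl | rfl) (rfl | rfl | rfl | rfl) <;>
      simp only [neg_neg, map_neg, hττ, true_or, or_true]
  have Pmap : ∀ g ∈ Γ, ∀ w x : V, (x = w ∨ x = -w ∨ x = τ w ∨ x = -(τ w)) →
      (g x = g w ∨ g x = -(g w) ∨ g x = τ (g w) ∨ g x = -(τ (g w))) := by
    rintro g hg w _ (rfl | rfl | rfl | rfl)
    · exact Or.inl rfl
    · exact Or.inr (Or.inl (map_neg g w))
    · exact Or.inr (Or.inr (Or.inl (hΓτ g hg w)))
    · exact Or.inr (Or.inr (Or.inr (by rw [map_neg, hΓτ g hg])))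
  have hDP : ∀ δ ∈ D, ∃ g ∈ Γ, δ = g δ₀ ∨ δ = -(g δ₀) ∨ δ = τ (g δ₀) ∨ δ = -(τ (g δ₀)) := by
    rintro δ ⟨g, hg, h⟩
    refine ⟨g, hg, ?_⟩
    rwa [hΓτ g hg] at h
  have htransD : ∀ δ ∈ D, ∀ δ' ∈ D, ∃ g ∈ Γ,
      g δ = δ' ∨ g δ = -δ' ∨ g δ = τ δ' ∨ g δ = -(τ δ') := by
    intro δ hδ δ' hδ'
    obtain ⟨g₁, hg₁, h₁⟩ := hDP δ hδ
    obtain ⟨g₂, hg₂, h₂⟩ := hDP δ' hδ'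
    refine ⟨g₂ * g₁⁻¹, Γ.mul_mem hg₂ (Γ.inv_mem hg₁), ?_⟩
    have h₃ := Pmap g₁⁻¹ (Γ.inv_mem hg₁) _ _ h₁
    rw [hinvapp] at h₃
    have h₄ := Pmap g₂ hg₂ _ _ h₃
    rw [← LinearEquiv.mul_apply] at h₄
    exact Ptrans _ _ _ (Psymm _ _ h₂) h₄
  -- the generators in the shape of `SignSymmetricTransvectionMonodromy` §4
  have hE4 : ∀ e ∈ E, (∃ r ∈ T, ∃ c : K, (e : V →ₗ[K] V) = oneParamTransvection B r c) ∨
      (∃ δ ∈ D, ∃ c : K,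
        (e : V →ₗ[K] V) = oneParamTransvection B δ c * oneParamTransvection B (τ δ) c) := by
    intro e he
    obtain ⟨g, hg, h | h | h⟩ := hE e he
    · exact Or.inl ⟨g rP, ⟨g, hg, Or.inl rfl⟩, c₁, by rw [h, hconj g hg, coe_oneParamTransvectionEquiv]⟩
    · exact Or.inl ⟨g rL, ⟨g, hg, Or.inr (Or.inr (Or.inl rfl))⟩, c₂, by
        rw [h, hconj g hg, coe_oneParamTransvectionEquiv]⟩
    · exact Or.inr ⟨g δ₀, ⟨g, hg, Or.inl rfl⟩, c₃, by
        rw [h, hconj2 g hg, LinearEquiv.coe_toLinearMap_mul, coe_oneParamTransvectionEquiv,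
          coe_oneParamTransvectionEquiv]⟩
  -- spanning
  have hTD : Submodule.span K (T ∪ D) = ⊤ := by
    refine span_eq_top_of_generators hB hBn hΓE (S := T ∪ D) (fun e he => ?_) hinv
    rcases hE4 e he with ⟨r, hr, c, hec⟩ | ⟨δ, hδ, c, hec⟩
    · exact Or.inl ⟨r, Or.inl hr, c, hec⟩
    · exact Or.inr ⟨δ, Or.inr hδ, τ δ, Or.inr (hDτ δ hδ), c, hec⟩
  have C8 : Submodule.span K RP = Module.End.eigenspace τ 1 :=
    span_signSymmetric_eq_eigenspace_one h2 hτ hTτ hTD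
  have C11 : Submodule.span K RN = Module.End.eigenspace τ (-1) :=
    span_signSymmetric_eq_eigenspace_neg_one h2 hτ hTτ hTD
  -- seeds and links
  have hrPT : rP ∈ T := ⟨1, Γ.one_mem, Or.inl (hone rP).symm⟩
  have hrLT : rL ∈ T := ⟨1, Γ.one_mem, Or.inr (Or.inr (Or.inl (hone rL).symm))⟩
  have hDσ0 : ∀ δ ∈ D, B δ (τ δ) = 0 := fun δ hδ => (C7 δ hδ).1
  have hlinkP' : ∃ r ∈ T, τ r = r ∧ ∃ δ ∈ D, B r δ ≠ 0 := by
    obtain ⟨g, hg, h⟩ := hlinkP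
    exact ⟨rP, hrPT, hrP, g δ₀, ⟨g, hg, Or.inl rfl⟩, h⟩
  have hlinkL' : ∃ r ∈ T, τ r = -r ∧ ∃ δ ∈ D, B r δ ≠ 0 := by
    obtain ⟨g, hg, h⟩ := hlinkL
    exact ⟨rL, hrLT, hrL, g δ₀, ⟨g, hg, Or.inl rfl⟩, h⟩
  have C9 : ∀ A' ⊆ RP, A'.Nonempty → A' ≠ RP → ∃ r ∈ A', ∃ ρ ∈ RP, ρ ∉ A' ∧ B r ρ ≠ 0 :=
    orthogonallyConnected_of_signSymmetric_orbits hB hBn h2 hτ hτB hΓE hΓτ hE4 hTτ hTneg hTst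
      (fun r hr _ => hT0 r hr) hDσ0 hDneg hDst hD0P htransTP htransD hlinkP' C8
  have C12 : ∀ A' ⊆ RN, A'.Nonempty → A' ≠ RN → ∃ r ∈ A', ∃ ρ ∈ RN, ρ ∉ A' ∧ B r ρ ≠ 0 :=
    orthogonallyConnected_of_signSymmetric_orbits_neg hB hBn h2 hτ hτB hΓE hΓτ hE4 hTτ hTneg hTst
      (fun r hr _ => hT0 r hr) hDσ0 hDneg hDst hD0N htransTN htransD hlinkL' C11
  exact ⟨C6, C7, C8, C9, fun _ => ⟨rP, hrPT, hrP⟩, C11, C12, fun _ => ⟨rL, hrLT, hrL⟩⟩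

/-! ## §4 The link from a symmetric confluence: `⟨r, Γδ⟩ ≠ 0` -/

/-- **The link of a fixed centre with the paired centres, from a symmetric `A₃`-confluence.** Setting of
`signPencil_clauses_of_orbitData` (`B` alternating non-degenerate, `2 ≠ 0`, `τ² = 1` a `B`-isometry, `Γ ≤ GL(V)`
commuting with `τ` and preserving `B`). Suppose a confluence point of the discriminant supplies vectors
`e₁, e₂, e₃` and `c₀` with `⟨e₁, e₃⟩ = 0`, `(c₀⟨e₁, e₂⟩)² = 1 = (c₀⟨e₂, e₃⟩)²` (the chain distinguished basis of a
symmetric `A₃` point: local monodromies `U_{e₂}(c₀)` and `U_{e₁}(c₀) U_{e₃}(c₀)`), and that the transvection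
`U_r(c)` along a `τ`-fixed or `τ`-anti-fixed centre `r` and the pair `U_δ(c') U_{τδ}(c')` are `Γ`-CONJUGATE to these
two local monodromies (Zariski: meridians of one irreducible component of the discriminant are conjugate). Then
`⟨r, g δ⟩ ≠ 0` for some `g ∈ Γ` — the link hypothesis of `signPencil_clauses_of_orbitData`. Proof: `U_r(c) = U_{g e₂}(c₀)`
gives `c⟨x, r⟩ r = c₀⟨x, g e₂⟩ g e₂`; `w := (U_{e₁}(c₀)U_{e₃}(c₀) - 1) e₂ = c₀⟨e₂, e₁⟩e₁ + c₀⟨e₂, e₃⟩e₃` has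
`⟨e₂, w⟩ = 2/c₀ ≠ 0` and `g' w ∈ span{δ, τδ}`; if `⟨r, Γδ⟩ = 0` then also `⟨r, Γτδ⟩ = 0` (`τ r = ±r`), so
`⟨r, g w⟩ = ⟨r, (g g'⁻¹)(g' w)⟩ = 0`, and pairing the first identity with `g w` gives `2⟨x, g e₂⟩ = 0` for all `x`,
i.e. `e₂ = 0` — absurd. [cite: Deligne1980, §4.4 (4.4.2^α)–(4.4.4^α) pp. 227–228] -/
theorem exists_link_of_conjugate_confluence (hB : B.IsAlt) (hBn : B.Nondegenerate) (h2 : (2 : K) ≠ 0)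
    {τ : V →ₗ[K] V} (hτ : τ ^ 2 = 1) (hτB : ∀ x y, B (τ x) (τ y) = B x y)
    {Γ : Subgroup (V ≃ₗ[K] V)} (hΓτ : ∀ g ∈ Γ, ∀ x, g (τ x) = τ (g x))
    (hΓB : ∀ g ∈ Γ, ∀ x y, B (g x) (g y) = B x y)
    {e₁ e₂ e₃ : V} {c₀ : K} (h13 : B e₁ e₃ = 0) (h12 : (c₀ * B e₁ e₂) ^ 2 = 1) (h23 : (c₀ * B e₂ e₃) ^ 2 = 1)
    {r δ : V} {c c' : K} (hr : τ r = r ∨ τ r = -r) {g g' : V ≃ₗ[K] V} (hg : g ∈ Γ) (hg' : g' ∈ Γ)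
    (hT : oneParamTransvectionEquiv B (hB r) c = g * oneParamTransvectionEquiv B (hB e₂) c₀ * g⁻¹)
    (hT' : oneParamTransvectionEquiv B (hB δ) c' * oneParamTransvectionEquiv B (hB (τ δ)) c' =
      g' * (oneParamTransvectionEquiv B (hB e₁) c₀ * oneParamTransvectionEquiv B (hB e₃) c₀) * g'⁻¹) :
    ∃ h ∈ Γ, B r (h δ) ≠ 0 := by
  have hττ : ∀ x, τ (τ x) = x := fun x => by
    rw [← Module.End.mul_apply, ← pow_two, hτ, Module.End.one_apply]
  have hc₀ : c₀ ≠ 0 := by rintro rfl; rw [zero_mul, zero_pow two_ne_zero] at h12; exact zero_ne_one h12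
  -- (a) `U_r(c) = U_{g e₂}(c₀)` pointwise
  have ha : ∀ x, (c * B x r) • r = (c₀ * B x (g e₂)) • g e₂ := by
    intro x
    have h := LinearEquiv.congr_fun (hT.trans (conj_oneParamTransvectionEquiv hB (hΓB g hg) e₂ c₀)) x
    rw [oneParamTransvectionEquiv_apply, oneParamTransvectionEquiv_apply] at h
    exact add_left_cancel h
  -- (b) the vector `w = (U_{e₁}(c₀) U_{e₃}(c₀) - 1) e₂` and `⟨e₂, w⟩ = 2 / c₀`
  set w : V := (c₀ * B e₂ e₃) • e₃ + (c₀ * B e₂ e₁) • e₁ with hw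
  have hTw : (oneParamTransvectionEquiv B (hB e₁) c₀ * oneParamTransvectionEquiv B (hB e₃) c₀) e₂ = e₂ + w := by
    have h31 : B e₃ e₁ = 0 := by rw [← hB.neg_eq, h13, neg_zero]
    rw [LinearEquiv.mul_apply, oneParamTransvectionEquiv_apply, oneParamTransvectionEquiv_apply, map_add,
      LinearMap.add_apply, map_smul, LinearMap.smul_apply, h31, smul_eq_mul, mul_zero, add_zero, hw, add_assoc]
  have hBw : c₀ * B e₂ w = 2 := by
    rw [hw, map_add, map_smul, map_smul, smul_eq_mul, smul_eq_mul]
    have e21 : B e₂ e₁ = -B e₁ e₂ := (hB.neg_eq e₁ e₂).symm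
    have h1 : c₀ * B e₂ e₁ * (c₀ * B e₂ e₁) = 1 := by
      rw [e21]
      linear_combination h12
    linear_combination h23 + h1
  -- (c) `g' w ∈ span{δ, τδ}`: explicitly from `hT'` applied to `g' e₂`
  obtain ⟨α, β, hαβ⟩ : ∃ α β : K, g' w = α • δ + β • τ δ := by
    have h := LinearEquiv.congr_fun hT' (g' e₂)
    rw [LinearEquiv.mul_apply, LinearEquiv.mul_apply, LinearEquiv.mul_apply,
      show g'⁻¹ (g' e₂) = e₂ by rw [← LinearEquiv.mul_apply, inv_mul_cancel, LinearEquiv.coe_one, id_eq], hTw, map_add,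
      oneParamTransvectionEquiv_apply, oneParamTransvectionEquiv_apply, map_add, LinearMap.add_apply, map_smul,
      LinearMap.smul_apply] at h
    refine ⟨c' * (B (g' e₂) δ + (c' * B (g' e₂) (τ δ)) • B (τ δ) δ), c' * B (g' e₂) (τ δ), ?_⟩
    have h2 : g' w = (g' e₂ + g' w) - g' e₂ := by abel
    rw [h2, ← h]
    module
  -- (d) suppose all links vanish
  by_contra hcon
  push Not at hcon
  have hconτ : ∀ h ∈ Γ, B r (h (τ δ)) = 0 := by
    intro h hh
    rw [hΓτ h hh]
    have e : B r (τ (h δ)) = B (τ r) (h δ) := by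
      conv_lhs => rw [← hττ r]
      rw [hτB]
    rw [e]
    rcases hr with hr | hr
    · rw [hr, hcon h hh]
    · rw [hr, map_neg, LinearMap.neg_apply, hcon h hh, neg_zero]
  have hgw : B r (g w) = 0 := by
    have hmem : g * g'⁻¹ ∈ Γ := Γ.mul_mem hg (Γ.inv_mem hg')
    have e : g w = (g * g'⁻¹) (g' w) := by
      rw [LinearEquiv.mul_apply, ← LinearEquiv.mul_apply g'⁻¹, inv_mul_cancel, LinearEquiv.coe_one, id_eq]
    rw [e, hαβ, map_add, map_smul, map_smul, map_add, map_smul, map_smul, smul_eq_mul, smul_eq_mul, hcon _ hmem,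
      hconτ _ hmem, mul_zero, mul_zero, add_zero]
  -- pairing (a) with `g w`: `2 ⟨x, g e₂⟩ = 0` for all `x`, hence `e₂ = 0`
  have hzero : ∀ x, B x (g e₂) = 0 := by
    intro x
    have h := congrArg (fun v => c₀ * B v (g w)) (ha x)
    simp only [map_smul, LinearMap.smul_apply, smul_eq_mul, hgw, mul_zero, hΓB g hg] at h
    -- h : 0 = c₀ * (c₀ * B x (g e₂) * B e₂ w)
    have h' : (2 : K) * (c₀ * B x (g e₂)) = 0 := by
      rw [← hBw]
      linear_combination -h
    exact (mul_eq_zero.1 ((mul_eq_zero.1 h').resolve_left h2)).resolve_left hc₀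
  have he₂ : g e₂ = 0 := by
    refine hBn.2 (g e₂) fun x => ?_   -- SeparatingRight: ∀ y, (∀ x, B x y = 0) → y = 0
    exact hzero x
  have he₂' : e₂ = 0 := (LinearEquiv.map_eq_zero_iff g).1 he₂
  rw [he₂', map_zero, mul_zero, zero_pow two_ne_zero] at h12
  exact zero_ne_one h12

end Literature.AlgebraicGeometry.HodgeTheory

end
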